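import Summits.BirchSwinnertonDyer.BirchSwinnertonDyer.Theorems.SignedLowerHalvesSharpFlatResiduePPartTwistCertificate
import Summits.BirchSwinnertonDyer.Rank1Residual.X11b.BDPRouteManin
import Literature.NumberTheory.DiophantineGeometry.AbcWave0GranvilleStarkTheorem2Proofs
import HarnessLib

/-!
# Leaf X8 (`p = 3`, `a₃ = ±3`), analytic rank ZERO, surjective image: k3-c5's anticyclotomic TWIST-PAIR bootstrap
# with every datum and transport binder DISCHARGED — per pair only the two FIELDS, the two twist models and the
# numerical certificate remain (cell `bsd-print-x8`, prover seat p4 «TWC road»; `--supports` item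
# stmt-BirchSwinnertonDyer-19003 `SprungLowerHalfAtThree` (clause (low₀), X8 ∧ r0); theorems only; a thin wrapper of
# `Theorems/SignedLowerHalvesSprungLowerHalfAtThreeTwistBootstrap{,Crux}.lean` (bsd-ssimc k3-c5 gen 8, p476757);
# closes nothing)

HONEST FRAMING (cell bsd-print-x8): PARTITION currency; this file does NOT prove the leaf `WAllCornerX8`. It is the
rank-ZERO twin of `X8TwistCertificate.X8.bsdp_rankOne_of_acLowerLinks_of_twistCertificate_field` (p4, companion
file `…TwistCertificateJetchev.lean`): k3-c5's `X8TwistBootstrap.X8.bsdp_of_twistBootstrap_of_surj` takes, besides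
the two fields and the two twist models, a parametrisation datum / Heegner datum / Heegner point for EACH field
(`Dt, H, ιC, P, hP, hc, hμ`; `Dt₂, H₂, ι₂, P₂, hP₂, hc₂, hμ₂`) and the transports `hu`, `htam`, `hsurjd`, `htam0`,
`hu₂`, `htam₂` as binders. All of these are DISCHARGED here by tree theorems, exactly as in the rank-one companion:
existence of a Manin-unit datum at a level prime to `9` with `E[3]` irreducible
(`X11b.exists_modularParametrizationData_not_dvd`: modularity `hnf`, Mazur 1978 Cor. 4.1 `hMaz`, Néron `hNS`), of a
Heegner datum and the Heegner point (`exists_dvd_sq_sub_discr_holds`, `nonempty_heegnerDatum_holds`,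
`heegnerPointComplex_mem_range_map_holds`), `#𝓞^× = 2` for `d < −4`, and at `3` SPLIT in both fields: good
reduction of the twists (`isSquare_discr_padic_of_heegner`, `hasGoodReductionAtPrime_quadraticTwist_iff_of_isSquare`),
`ord₃ u = 0` (`X11b.padicValRat_u_eq_zero_of_twist_good`), the Tamagawa transports
(`O5.TwistTamagawa.padicValNat_tamagawaProduct_twist_of_heegner_three`), surjectivity of `ρ̄_{Wd,3}`
(`X11b.surj_twist_model`). So at a rank-zero X8 pair with `ρ̄_{E,3}` onto and `3 ∤ ∏c(E)`, `BSD(E,3)` follows from: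
the PUBLISHED facts BY NAME (JSW 2017 Thm. 3.3.1 `h331`, Gross–Zagier, Kolyvagin, Kolyvagin's index bound, Wuthrich
2014 Prop. 21 `hW`, GZK, modularity, Mazur, Néron); the FIRST field `K₁` (every `ℓ ∣ N_E` and `3` split,
`d < −4`) with a globally minimal model `Wd` of the RANK-ONE twist `E^{(d₁)}` (`hrd : r_an(Wd) = 1`, a READ/instrument
datum: `w = −1`, `L'(Wd,1) ≠ 0`); the SECOND field `K₂` (every `ℓ ∣ N_{Wd}` and `3` split, `d < −4`) with a globally
minimal model `Wdd` of `Wd^{(d₂)} = E^{(d₁d₂)}`, `L(Wd^{(d₂)},1) ≠ 0` and the 3-adic Tamagawa ZONE of `Wdd`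
(numerical); and the ONE displayed link `hLA` at every datum of level `N_E` over `K₁` (crux X8-AC posted to the cell
planner: the anticyclotomic Eisenstein divisibility at `(3, ±3)` — NOT in print). «beyond-print theorem: NO»;
CONDITIONAL; closes nothing; 0 census moves. The per-pair values `(d₁, Wd, d₂, Wdd, zone)` for the open X8 cells are
this seat's kit census (HOME/STATUS.md).

References: [JetchevSkinnerWan2017] Thm. 3.3.1, §7.4.1–§7.4.2; [KolyvaginEulerSystems1990] Thm. A; [McCallumLMS1991]
§1; [Wuthrich2014] Prop. 21; [GrossZagier1986] I.(6.3), V.§2; [Mazur1978] Cor. 4.1; [Serre1972] §1.11 Prop. 12;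
[Miller2011LMS] Def. 1.1.
-/

set_option autoImplicit false
set_option linter.dupNamespace false

noncomputable section

open scoped Classical NumberField

open WeierstrassCurve NumberField IsDedekindDomain Literature.NumberTheory.EllipticCurves
  Literature.NumberTheory.EllipticCurves.ModularForms
  Literature.NumberTheory.EllipticCurves.Rank1Residual
  Literature.NumberTheory.EllipticCurves.Rank1Residual.Typed
  Literature.NumberTheory.EllipticCurves.KrizLi2019
  Summit.BirchSwinnertonDyer.Rank1Residual

namespace Summit.BirchSwinnertonDyer.BirchSwinnertonDyer.Theorems.X8TwistCertificate

/-- **The Heegner-twist transports at `3` for a curve GOOD at `3` and a field with `3` SPLIT** (bookkeeping used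
twice below): the globally minimal model `Wd = Cd • E^{(d_K)}` is GOOD at `3`, `ord₃ u(Cd) = 0`, and
`ord₃ ∏c(Wd) = ord₃ ∏c(E)`. Tree theorems only (`isSquare_discr_padic_of_heegner`,
`hasGoodReductionAtPrime_quadraticTwist_iff_of_isSquare`, `X11b.padicValRat_u_eq_zero_of_twist_good`,
`O5.TwistTamagawa.padicValNat_tamagawaProduct_twist_of_heegner_three`, `SatisfiesHeegnerHypothesis.not_dvd_discr`).
[cite: SilvermanAEC2009, VII.5 Prop. 5.1(a) and X.5 Cor. 5.4] [cite: Serre1973, Ch. II §3.3 Thm 3] -/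
theorem twist_transports_three (W : WeierstrassCurve ℚ) [W.IsElliptic] [W.IsGloballyMinimal]
    (hgood : W.HasGoodReductionAtPrime 3)
    (K : Type) [Field K] [NumberField K] (hK : IsImaginaryQuadratic K)
    (hHN : SatisfiesHeegnerHypothesis (W.conductorNorm ℤ) K) (hHp : SatisfiesHeegnerHypothesis 3 K)
    (Wd : WeierstrassCurve ℚ) [Wd.IsElliptic] [Wd.IsGloballyMinimal] (Cd : VariableChange ℚ)
    (hWd : Cd • W.quadraticTwist (NumberField.discr K : ℚ) = Wd) :
    Wd.HasGoodReductionAtPrime 3 ∧ padicValRat 3 (Cd.u : ℚ) = 0 ∧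
      padicValNat 3 Wd.tamagawaProduct = padicValNat 3 W.tamagawaProduct := by
  have hD0 : (NumberField.discr K : ℚ) ≠ 0 := by exact_mod_cast NumberField.discr_ne_zero K
  haveI hEt : (W.quadraticTwist (NumberField.discr K : ℚ)).IsElliptic := W.isElliptic_quadraticTwist hD0
  have h3d : ¬ ((3 : ℕ) : ℤ) ∣ NumberField.discr K :=
    Literature.SatisfiesHeegnerHypothesis.not_dvd_discr hK.1 hHp Nat.prime_three (dvd_refl 3)
  have hsq : IsSquare (algebraMap ℚ ℚ_[3] (NumberField.discr K : ℚ)) :=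
    X11b.isSquare_discr_padic_of_heegner K hK hHp 3 (dvd_refl 3)
  have hgoodt : (W.quadraticTwist (NumberField.discr K : ℚ)).HasGoodReductionAtPrime 3 :=
    (AdditiveBranchIMCGordTwoRankOne.HeegnerKolyvagin.hasGoodReductionAtPrime_quadraticTwist_iff_of_isSquare
      W hD0 hsq).mpr hgood
  have hgoodd : Wd.HasGoodReductionAtPrime 3 := by
    rw [← hWd]
    exact (AdditiveBranchIMCGordTwoRankOne.HeegnerKolyvagin.hasGoodReductionAtPrime_smul_iff' _ Cd 3).mpr hgoodt
  refine ⟨hgoodd, X11b.padicValRat_u_eq_zero_of_twist_good W 3 (by exact_mod_cast h3d) hgood Cd hWd hgoodd, ?_⟩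
  exact O5.TwistTamagawa.padicValNat_tamagawaProduct_twist_of_heegner_three W Wd K hK hHN
    (by exact_mod_cast h3d) Cd hWd

/-- **`BSD(E,3)` at a RANK-ZERO X8 pair with `ρ̄_{E,3}` onto by k3-c5's TWIST-PAIR bootstrap, every datum and
transport binder DISCHARGED.** DATA per pair: the FIRST field `K₁` — imaginary quadratic, `d_{K₁} < −4`, every
`ℓ ∣ N_E` split (`hHN`), `3` split (`hHp`) — with a globally minimal model `Wd = Cd • E^{(d_{K₁})}` of analytic
rank ONE (`hrd`); `3 ∤ ∏_ℓ c_ℓ(E)` (`htam0`); the SECOND field `K₂` — imaginary quadratic, `d_{K₂} < −4`, every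
`ℓ ∣ N_{Wd}` split (`hHN₂`), `3` split (`hHp₂`) — with a globally minimal model `Wdd = Cdd • Wd^{(d_{K₂})}`,
`L(Wd^{(d_{K₂})},1) ≠ 0` (`hLt₂`) and the 3-adic Tamagawa ZONE of `Wdd` (`hzone`, numerical); the ONE displayed link
`hLA` at every datum of level `N_E` over `K₁`. PUBLISHED BY NAME: `hW` (Wuthrich 2014 Prop. 21 — the rank-zero upper
half for `E`), `h331` (JSW 3.3.1), Gross–Zagier / Kolyvagin / Kolyvagin's index bound at every `(N, V, K)`, GZK,
modularity (`hmod`, `hmodP`, `hnf`), Mazur 1978 Cor. 4.1 (`hMaz`), Néron (`hNS`). Proof: the transports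
(`twist_transports_three`, `X11b.surj_twist_model`), the data (existence theorems; `X11b.exists_modularParametrizationData_not_dvd`
at the levels `N_E` and `N_{Wd}`, both prime to `9` by good reduction at `3`; `E[3]`, `Wd[3]` irreducible), `#𝓞^× = 2`
twice, then `X8TwistBootstrap.X8.missingLowerBoundAt_of_twistBootstrap` (p476757) and
`Typed.X8.bsdp_of_missingLowerBoundAt_of_surj`. CONDITIONAL on `hLA` and the data; closes nothing.
[cite: JetchevSkinnerWan2017, Thm. 3.3.1, §7.4.1–§7.4.2 (arXiv:1512.06894 pp. 11, 30–31)]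
[cite: McCallumLMS1991, §1 Theorem (Kolyvagin), p. 296] [cite: Wuthrich2014, Prop. 21 (p. 400)]
[cite: Mazur1978, Cor. 4.1] [cite: Miller2011LMS, §1 and Def. 1.1] -/
theorem X8.bsdp_rankZero_of_acLowerLinks_of_twistPair_fields
    (hW : Wuthrich2014.sha_dvd_analyticSha)
    (h331 : JetchevSkinnerWan2017.thm331_anticyclotomicControl_general)
    (hGZ : ∀ (N : ℕ) [NeZero N] (V : WeierstrassCurve ℚ) (K : Type) [Field K] [NumberField K],
      gross_zagier N V K)
    (hKo : ∀ (N : ℕ) [NeZero N] (V : WeierstrassCurve ℚ) (K : Type) [Field K] [NumberField K],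
      kolyvagin N V K)
    (hB : ∀ (N : ℕ) [NeZero N] (V : WeierstrassCurve ℚ) (K : Type) [Field K] [NumberField K],
      Kolyvagin1990_padicValNat_card_sha_le N V K)
    (hGZK : rank_eq_analyticRank_of_analyticRank_le_one) (hmod : hasEntireLFunction_rat)
    (hmodP : nonempty_modularParametrizationData) (hnf : exists_isNewformOf)
    (hMaz : mazur_not_dvd_maninConstant_of_odd) (hNS : integral_neronScaling_of_isGloballyMinimal)
    (W : WeierstrassCurve ℚ) [W.IsElliptic] [W.IsGloballyMinimal] (hX : ClassX8 W 3)
    (hr : W.analyticRank = 0) (hsurj : Surj W 3) (htam0 : ¬ (3 : ℕ) ∣ W.tamagawaProduct)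
    -- the first field and the rank-ONE twist
    (K : Type) [Field K] [NumberField K] (hK : IsImaginaryQuadratic K) (hdK : NumberField.discr K < -4)
    (hHN : SatisfiesHeegnerHypothesis (W.conductorNorm ℤ) K) (hHp : SatisfiesHeegnerHypothesis 3 K)
    (Wd : WeierstrassCurve ℚ) [Wd.IsElliptic] [Wd.IsGloballyMinimal] (Cd : VariableChange ℚ)
    (hWd : Cd • W.quadraticTwist (NumberField.discr K : ℚ) = Wd) (hrd : Wd.analyticRank = 1)
    -- the second field and the rank-ZERO twist in the zone
    (K₂ : Type) [Field K₂] [NumberField K₂] (hK₂ : IsImaginaryQuadratic K₂) (hdK₂ : NumberField.discr K₂ < -4)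
    (hHN₂ : SatisfiesHeegnerHypothesis (Wd.conductorNorm ℤ) K₂) (hHp₂ : SatisfiesHeegnerHypothesis 3 K₂)
    (Wdd : WeierstrassCurve ℚ) [Wdd.IsElliptic] [Wdd.IsGloballyMinimal] (Cdd : VariableChange ℚ)
    (hWdd : Cdd • Wd.quadraticTwist (NumberField.discr K₂ : ℚ) = Wdd)
    (hLt₂ : (Wd.quadraticTwist (NumberField.discr K₂ : ℚ)).entireLFunction 1 ≠ 0)
    (hzone : ∃ q : ℚ, Wdd.entireLFunction 1 / (Wdd.realPeriodRat : ℂ) = (q : ℂ) ∧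
      padicValRat 3 q + 2 * padicValNat 3 Wdd.torsionOrder ≤ padicValNat 3 Wdd.tamagawaProduct)
    -- the displayed link at EVERY datum of level `N_E` over `K`
    (hLA : ∀ (N : ℕ) [NeZero N] (Dt : ModularParametrizationData W N) (H : HeegnerDatum N (NumberField.discr K))
      (ιC : K →+* ℂ) (P : (W.baseChange K).toAffine.Point),
      W.conductorNorm ℤ = N → WeierstrassCurve.Affine.Point.map ιC.toRatAlgHom P = heegnerPointComplex Dt H →
      ¬ ((3 : ℕ) : ℤ) ∣ Dt.c →
      ∀ (κ : ZpExtension K 3), κ.IsAnticyclotomic →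
        ∀ (γ : Field.absoluteGaloisGroup K) [Fact (κ.IsTopGenerator γ)] (𝔭 : HeightOneSpectrum (𝓞 K))
          (h𝔭 : (((3 : ℕ) : ℕ) : 𝓞 K) ∈ 𝔭.asIdeal) (he : 𝔭.asIdeal.ramificationIdx (𝓞 ℚ) = 1)
          (hf : 𝔭.asIdeal.inertiaDeg (𝓞 ℚ) = 1),
          X11b.IMCLowerWaldspurgerOnTreeGoodAt 3 κ 𝔭 γ (X11b.embAt K 3 𝔭 h𝔭 he hf) P) :
    BSDp W 3 := by
  have hp2 : (3 : ℕ) ≠ 2 := by decide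
  haveI : NeZero (W.conductorNorm ℤ) := ⟨(W.conductorNorm_pos_holds).ne'⟩
  haveI : NeZero (Wd.conductorNorm ℤ) := ⟨(Wd.conductorNorm_pos_holds).ne'⟩
  have hgood : W.HasGoodReductionAtPrime 3 := hX.2.1.1
  -- transports for the first twist
  obtain ⟨hgoodd, hu, htam⟩ := twist_transports_three W hgood K hK hHN hHp Wd Cd hWd
  have hsurjd : Surj Wd 3 := X11b.surj_twist_model W 3 K hsurj Cd hWd
  have htam0d : ¬ (3 : ℕ) ∣ Wd.tamagawaProduct := by
    rw [dvd_iff_padicValNat_ne_zero Wd.tamagawaProduct_pos'.ne', htam, padicValNat.eq_zero_of_not_dvd htam0]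
    exact fun h ↦ h rfl
  -- transports for the second twist
  obtain ⟨-, hu₂, htam₂⟩ := twist_transports_three Wd hgoodd K₂ hK₂ hHN₂ hHp₂ Wdd Cdd hWdd
  -- units of the two fields
  have hμ : ¬ (3 : ℕ) ∣ Units.torsionOrder K := by
    rw [Literature.NumberTheory.DiophantineGeometry.torsionOrder_eq_two_of_discr_lt hK.1 hdK]; decide
  have hμ₂ : ¬ (3 : ℕ) ∣ Units.torsionOrder K₂ := by
    rw [Literature.NumberTheory.DiophantineGeometry.torsionOrder_eq_two_of_discr_lt hK₂.1 hdK₂]; decide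
  -- the first datum (level `N_E`, `9 ∤ N_E`, `E[3]` irreducible)
  have h9N : ¬ 3 ^ 2 ∣ W.conductorNorm ℤ := fun h ↦
    ((W.dvd_conductorNorm_iff_not_hasGoodReductionAtPrime 3).mp (dvd_trans (dvd_pow_self 3 two_ne_zero) h)) hgood
  obtain ⟨Dt, hc⟩ := X11b.exists_modularParametrizationData_not_dvd hnf hMaz hNS W rfl Nat.prime_three hp2 h9N
    (ClassX8.irr W 3 hX)
  obtain ⟨β, hβ⟩ := exists_dvd_sq_sub_discr_holds (W.conductorNorm ℤ) K hK hHN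
  obtain ⟨H, -⟩ := nonempty_heegnerDatum_holds (W.conductorNorm ℤ) K hK hβ
  obtain ⟨ιC⟩ : Nonempty (K →+* ℂ) := inferInstance
  obtain ⟨P, hP⟩ := heegnerPointComplex_mem_range_map_holds (W.conductorNorm ℤ) W K hK hHN Dt H ιC
  -- the second datum (level `N_{Wd}`, `9 ∤ N_{Wd}`, `Wd[3]` irreducible)
  have h9N₂ : ¬ 3 ^ 2 ∣ Wd.conductorNorm ℤ := fun h ↦
    ((Wd.dvd_conductorNorm_iff_not_hasGoodReductionAtPrime 3).mp (dvd_trans (dvd_pow_self 3 two_ne_zero) h)) hgoodd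
  obtain ⟨Dt₂, hc₂⟩ := X11b.exists_modularParametrizationData_not_dvd hnf hMaz hNS Wd rfl Nat.prime_three hp2 h9N₂
    (hasIrreducibleModPGaloisRep_of_hasSurjectiveModNGaloisRep Wd 3 hsurjd)
  obtain ⟨β₂, hβ₂⟩ := exists_dvd_sq_sub_discr_holds (Wd.conductorNorm ℤ) K₂ hK₂ hHN₂
  obtain ⟨H₂, -⟩ := nonempty_heegnerDatum_holds (Wd.conductorNorm ℤ) K₂ hK₂ hβ₂
  obtain ⟨ι₂⟩ : Nonempty (K₂ →+* ℂ) := inferInstance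
  obtain ⟨P₂, hP₂⟩ := heegnerPointComplex_mem_range_map_holds (Wd.conductorNorm ℤ) Wd K₂ hK₂ hHN₂ Dt₂ H₂ ι₂
  -- k3-c5's bootstrap gives (low₀); Wuthrich closes the rank-zero surjective branch
  exact Typed.X8.bsdp_of_missingLowerBoundAt_of_surj W 3 hW hGZK hmod hX hsurj hr
    (X8TwistBootstrap.X8.missingLowerBoundAt_of_twistBootstrap h331 hGZK hmod hmodP W hX hr (W.conductorNorm ℤ) rfl K
      (hGZ _ W K) (hKo _ W K) hK hHN hHp Dt H ιC P hP hc hμ Wd Cd hWd hu hrd htam hsurjd htam0d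
      (hLA (W.conductorNorm ℤ) Dt H ιC P rfl hP hc)
      (Wd.conductorNorm ℤ) K₂ (hGZ _ Wd K₂) (hKo _ Wd K₂) (hB _ Wd K₂) hK₂ hHN₂ Dt₂ H₂ ι₂ P₂ hP₂ hc₂ hμ₂ hLt₂
      Wdd Cdd hWdd hu₂ htam₂ hzone)

end Summit.BirchSwinnertonDyer.BirchSwinnertonDyer.Theorems.X8TwistCertificate

end
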